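import Literature.NumberTheory.Automorphic.TorusUnitBoxUnfolding
import HarnessLib

/-!
# Unfolding an integral over the adelic torus one place at a time: a general integrand

Topic `NumberTheory/Automorphic`; namespace `Literature.NumberTheory.Automorphic`. Proof file
(theorems only), companion of `TorusUnitBoxUnfolding`. There the integral `∫_{B(G)} f` of an integrand
SCALING under the translates `ϖ_v^μ`, `f(ϖ_v^μ a) = c_μ f(a)`, is factorised as
`(Σ_μ c_μ) ∫_{B(insert v G)} f` (unramified places). At a RAMIFIED place there is no scaling, but the
disjoint decomposition of the `v`-integral part of `B(G)` into the translates `ϖ_v^μ B(insert v G)`,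
`μ ∈ ℕⁿ`, still gives, for every `f ≥ 0` vanishing at the points of `B(G)` with an entry of
`v`-valuation `> 1`:

  `∫_{B(G)} f dν = Σ_{μ ∈ ℕⁿ} ∫_{B(insert v G)} f(ϖ_v^μ a) dν(a)`  (`setLIntegral_unitBox_eq_tsum`),

and, summing only finitely many translates, the monotone approximations
`Σ_{μ ∈ F} ∫_{B(insert v G)} f(ϖ_v^μ a) dν(a) ≤ ∫_{B(G)} f dν` for every finite `F ⊆ ℕⁿ` WITHOUT any
support hypothesis (`sum_setLIntegral_unitBox_translate_le`). This is the bookkeeping by which the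
bad-place part of the unfolded Rankin–Selberg integral at `s = 1` (the hypothesis `hfin` of
`PairLFunctionPolesEqConjFirstMoment`) becomes a sum over the valuations at the bad places of integrals
over units and the archimedean torus. [folklore]

## References

* H. Jacquet, J. A. Shalika, *On Euler products and the classification of automorphic
  representations I*, Amer. J. Math. 103 (1981), §2, §4 [JacquetShalikaAJM1981].
* J. W. Cogdell, *Analytic theory of L-functions for GL_n* (2004), §2.3 [CogdellAnalyticTheory2004].
-/

noncomputable section

open MeasureTheory Measure NumberField IsDedekindDomain Set Filter Topology
open Literature.NumberTheory.GaloisRepresentations (ideleGroup localUnits)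
open scoped ENNReal NNReal Pointwise

namespace Literature.NumberTheory.Automorphic

section Decomposition

variable {n : ℕ} {K : Type} [Field K] [NumberField K]
variable [MeasurableSpace (ideleGroup K)] [BorelSpace (ideleGroup K)]

attribute [local instance] secondCountableTopology_ideleGroup

variable (νA : Measure (Fin n → ideleGroup K)) [νA.IsMulLeftInvariant]

variable {v : HeightOneSpectrum (𝓞 K)} {ϖ : (v.adicCompletion K)ˣ}

/-- **Finitely many translates**: for every finite set `F` of exponents and every `f ≥ 0`,
`Σ_{μ ∈ F} ∫_{B(insert v G)} f(ϖ_v^μ a) dν(a) ≤ ∫_{B(G)} f dν` for every `f ≥ 0` (the translates `ϖ_v^μ B(insert v G)` are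
disjoint subsets of `B(G)`; no support hypothesis). [folklore] -/
theorem sum_setLIntegral_unitBox_translate_le
    (hϖ : Valued.v (ϖ : v.adicCompletion K) = WithZero.exp (-1 : ℤ))
    {G : Set (HeightOneSpectrum (𝓞 K))} (hv : v ∉ G) (f : (Fin n → ideleGroup K) → ℝ≥0∞)
    (F : Finset (Fin n → ℕ)) :
    ∑ mu ∈ F, ∫⁻ a in unitBox (insert v G), f (localTorusPow ϖ mu * a) ∂νA ≤ ∫⁻ a in unitBox G, f a ∂νA := by
  have hterm : ∀ mu : Fin n → ℕ, ∫⁻ a in unitBox (n := n) (K := K) (insert v G), f (localTorusPow ϖ mu * a) ∂νA =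
      ∫⁻ a in localTorusPow ϖ mu • unitBox (n := n) (K := K) (insert v G), f a ∂νA :=
    fun mu => (setLIntegral_smul_torus_eq νA _ _ f).symm
  simp_rw [hterm]
  rw [← lintegral_biUnion_finset (fun mu _ mu' _ hne => pairwise_disjoint_localTorusPow_smul_unitBox hϖ G hne)
    (fun mu _ => measurableSet_smul_unitBox _ _)]
  exact lintegral_mono_set (Set.iUnion₂_subset fun mu _ => localTorusPow_smul_unitBox_subset hv mu)

/-- **Unfolding one place, general integrand.** For `v ∉ G`, a uniformizer `ϖ` at `v`, a measurable
`f ≥ 0` on the torus vanishing at the points of `B(G)` having an entry of `v`-valuation `> 1` (no measurability needed), and a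
left-invariant measure `ν`:
`∫_{B(G)} f dν = Σ_{μ ∈ ℕⁿ} ∫_{B(insert v G)} f(ϖ_v^μ a) dν(a)`. [folklore] -/
theorem setLIntegral_unitBox_eq_tsum
    (hϖ : Valued.v (ϖ : v.adicCompletion K) = WithZero.exp (-1 : ℤ))
    {G : Set (HeightOneSpectrum (𝓞 K))} (hv : v ∉ G)
    {f : (Fin n → ideleGroup K) → ℝ≥0∞}
    (hsupp : ∀ a ∈ unitBox (n := n) (K := K) G,
      (∃ i, 1 < Valued.v (((a i : ideleGroup K) : AdeleRing (𝓞 K) K).2 v)) → f a = 0) :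
    ∫⁻ a in unitBox G, f a ∂νA = ∑' mu : Fin n → ℕ, ∫⁻ a in unitBox (insert v G), f (localTorusPow ϖ mu * a) ∂νA := by
  set S : Set (Fin n → ideleGroup K) := ⋃ mu : Fin n → ℕ, localTorusPow ϖ mu • unitBox (n := n) (K := K) (insert v G)
    with hS
  have hSmeas : MeasurableSet S := MeasurableSet.iUnion fun mu => measurableSet_smul_unitBox _ _
  have hSsub : S ⊆ unitBox G := Set.iUnion_subset fun mu => localTorusPow_smul_unitBox_subset hv mu
  -- `f = 1_S f` on `B(G)`
  have hind : ∀ a ∈ unitBox (n := n) (K := K) G, f a = S.indicator f a := by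
    intro a ha
    by_cases haS : a ∈ S
    · rw [Set.indicator_of_mem haS]
    · rw [Set.indicator_of_notMem haS]
      refine hsupp a ha ?_
      by_contra hno
      push Not at hno
      obtain ⟨mu, hmu⟩ := exists_mem_smul_unitBox_of_valued_le_one hϖ ha hno
      exact haS (Set.mem_iUnion.2 ⟨mu, hmu⟩)
  rw [setLIntegral_congr_fun (measurableSet_unitBox G) hind, lintegral_indicator hSmeas,
    Measure.restrict_restrict hSmeas, Set.inter_eq_left.2 hSsub, hS,
    lintegral_iUnion (fun mu => measurableSet_smul_unitBox _ _)
      (pairwise_disjoint_localTorusPow_smul_unitBox hϖ G)]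
  exact tsum_congr fun mu => setLIntegral_smul_torus_eq νA _ _ f

/-- **Finiteness transfers**: under the same support hypothesis, `∫_{B(G)} f dν < ∞` as soon as the
partial sums `Σ_{μ ∈ F} ∫_{B(insert v G)} f(ϖ_v^μ a) dν(a)` are bounded by a finite constant. [folklore] -/
theorem setLIntegral_unitBox_ne_top_of_sum_le
    (hϖ : Valued.v (ϖ : v.adicCompletion K) = WithZero.exp (-1 : ℤ))
    {G : Set (HeightOneSpectrum (𝓞 K))} (hv : v ∉ G)
    {f : (Fin n → ideleGroup K) → ℝ≥0∞}
    (hsupp : ∀ a ∈ unitBox (n := n) (K := K) G,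
      (∃ i, 1 < Valued.v (((a i : ideleGroup K) : AdeleRing (𝓞 K) K).2 v)) → f a = 0)
    {C : ℝ≥0∞} (hC : C ≠ ⊤)
    (hbound : ∀ F : Finset (Fin n → ℕ), ∑ mu ∈ F, ∫⁻ a in unitBox (insert v G), f (localTorusPow ϖ mu * a) ∂νA ≤ C) :
    ∫⁻ a in unitBox G, f a ∂νA ≠ ⊤ := by
  rw [setLIntegral_unitBox_eq_tsum νA hϖ hv hsupp, ENNReal.tsum_eq_iSup_sum]
  exact ne_top_of_le_ne_top hC (iSup_le hbound)

end Decomposition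

end Literature.NumberTheory.Automorphic
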